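import Mathlib.MeasureTheory.Integral.Prod
import HarnessLib

/-!
# The Fubini step of Harish-Chandra's descent: a unit-mass kernel may be integrated away
(Harish-Chandra (notes by van Dijk), *Harmonic Analysis on Reductive p-adic Groups*, LNM 162 (1970), Part I §3, proof of Lemma 23; Folland (1995), Thm. 2.37 (Fubini))

Topic `MeasureTheory/Group`; namespace `Literature.MeasureTheory.Group`.  THEOREMS ONLY (no definition, no named fact, no instance, no notation, no `sorry`); Mathlib only.  Cell
`pub/hodgecm-mathlib` (D-0151), crux H413 = stmt-HodgeConjecture-24833, floor-2 line «N6nsGerm», binder `hD` of ★ `exists_nhds_stableOrbitalIntegralRel_eq_of_central_singular_inv`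
(p841647) — brick **B4-meas FILE M2b-γ** (LEAD F0P3a-plan (g9) T8-88 register); seat F0P3a-p08 (g13).  HONEST LABEL: HC_CM is proved only modulo the printed citations until rung 0 closes;
generic measure theory, no letter.

THE MATHEMATICS.  `(X, μ)`, `(Y, μ′)` s-finite measure spaces (in the application `X = G⧸T` with `ν∕ν_T`, `Y = M⧸T` with `ν_M∕ν_T`), `F ∈ L¹(μ)` (the orbital integrand `ψ̃` of a regular
element), `A : X × Y → ℝ` jointly measurable, non-negative, with UNIT MASS `∫_Y A(x, y) dμ′(y) = 1` wherever `F(x) ≠ 0` (the descended cut-off: `∫_{M⧸T} ∫_T β(y s k⁻¹) = ∫_M β(y k) = 1`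
on `C·M`).  Then `(x, y) ↦ F(x) A(x, y)` is integrable on `μ ⊗ μ′` (Tonelli: `∫∫ |F| A = ∫ |F|`), and
`∫_Y (∫_X F(x) A(x, y) dμ(x)) dμ′(y) = ∫_X F dμ` (Fubini, then the unit mass).

* `integrable_mul_kernel_of_integral_eq_one`, **`integral_integral_mul_kernel_eq_integral`**.

## References
* [HarishChandra1970] Harish-Chandra (notes by G. van Dijk), *Harmonic Analysis on Reductive p-adic Groups*, LNM 162 (1970), Part I §3 (proof of Lemma 23).
* [Folland1995] G. B. Folland, *A Course in Abstract Harmonic Analysis* (1995), §2.6 (Weil's formula) and Thm. 2.37-type Fubini–Tonelli.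
-/

set_option autoImplicit false

noncomputable section

open MeasureTheory MeasureTheory.Measure Set Filter Function
open scoped ENNReal

namespace Literature.MeasureTheory.Group

section Fubini

variable {X Y : Type*} [MeasurableSpace X] [MeasurableSpace Y] (μ : Measure X) (μ' : Measure Y) [SFinite μ] [SFinite μ']

omit [SFinite μ] in
/-- **Integrability of `F(x)·A(x, y)` on the product** from `F ∈ L¹(μ)` and the unit mass of the non-negative kernel `A` where `F ≠ 0` (Tonelli: `∫∫ |F|A = ∫ |F| < ∞`).
[cite: HarishChandra1970, Part I §3 (proof of Lemma 23)] -/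
theorem integrable_mul_kernel_of_integral_eq_one {F : X → ℂ} (hF : Integrable F μ) {A : X → Y → ℝ} (hA : Measurable (uncurry A))
    (hA0 : ∀ x y, 0 ≤ A x y) (hA1 : ∀ x, F x ≠ 0 → ∫ y, A x y ∂μ' = 1) :
    Integrable (uncurry fun x y => F x * (A x y : ℂ)) (μ.prod μ') := by
  have hmeas : AEStronglyMeasurable (uncurry fun x y => F x * (A x y : ℂ)) (μ.prod μ') := by
    refine (hF.1.comp_fst.mul ?_)
    exact (Complex.continuous_ofReal.measurable.comp hA).aestronglyMeasurable
  rw [integrable_prod_iff hmeas]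
  constructor
  · refine Eventually.of_forall fun x => ?_
    by_cases hx : F x = 0
    · have h0 : (fun y => uncurry (fun x y => F x * (A x y : ℂ)) (x, y)) = fun _ => 0 := by
        funext y; simp only [uncurry_apply_pair, hx, zero_mul]
      rw [h0]; exact integrable_zero _ _ _
    · have hAx : Integrable (A x) μ' := Integrable.of_integral_ne_zero (by rw [hA1 x hx]; exact one_ne_zero)
      simp only [uncurry_apply_pair]
      exact (hAx.ofReal.const_mul (F x))
  · -- `x ↦ ∫ ‖F x · A x y‖ dμ′ = ‖F x‖ · ∫ A x y = ‖F x‖` (or `0`)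
    have hnorm : ∀ x, ∫ y, ‖uncurry (fun x y => F x * (A x y : ℂ)) (x, y)‖ ∂μ' = ‖F x‖ * ∫ y, A x y ∂μ' := by
      intro x
      simp only [uncurry_apply_pair, norm_mul, Complex.norm_real, Real.norm_eq_abs, abs_of_nonneg (hA0 x _)]
      rw [integral_const_mul]
    simp_rw [hnorm]
    refine (hF.norm.congr ?_)
    refine Eventually.of_forall fun x => ?_
    by_cases hx : F x = 0
    · simp only [hx, norm_zero, zero_mul]
    · simp only [hA1 x hx, mul_one]

/-- **THE FUBINI STEP OF THE DESCENT**: `∫_Y ∫_X F(x) A(x, y) dμ dμ′ = ∫_X F dμ` for `F ∈ L¹(μ)` and a jointly measurable non-negative kernel `A` of unit mass in `y` wherever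
`F ≠ 0`. [cite: HarishChandra1970, Part I §3 (proof of Lemma 23)] [cite: Folland1995, §2.6] -/
theorem integral_integral_mul_kernel_eq_integral {F : X → ℂ} (hF : Integrable F μ) {A : X → Y → ℝ} (hA : Measurable (uncurry A))
    (hA0 : ∀ x y, 0 ≤ A x y) (hA1 : ∀ x, F x ≠ 0 → ∫ y, A x y ∂μ' = 1) :
    ∫ y, ∫ x, F x * (A x y : ℂ) ∂μ ∂μ' = ∫ x, F x ∂μ := by
  have hint := integrable_mul_kernel_of_integral_eq_one μ μ' hF hA hA0 hA1
  rw [← integral_integral_swap hint]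
  refine integral_congr_ae (Eventually.of_forall fun x => ?_)
  beta_reduce
  by_cases hx : F x = 0
  · simp only [hx, zero_mul, integral_zero]
  · rw [integral_const_mul, integral_complex_ofReal, hA1 x hx, Complex.ofReal_one, mul_one]

end Fubini

end Literature.MeasureTheory.Group

end
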